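import Summits.AtomisticToContinuum.HydrodynamicLimit.Theses.LambertianContactSwap
import Summits.AtomisticToContinuum.HydrodynamicLimit.Theorems.LambertianContactSwapCollisionMomentBoundRung0
import HarnessLib

/-!
# `LambertianContactSwap.CollisionMomentBound` (stmt-AtomisticToContinuum-12102): reduction of the item to a
# near-contact (shell) bound for the TIME-EVOLVED local Gibbs law

Helper file (`--supports stmt-AtomisticToContinuum-12102`).  Rung 0 (`…CollisionMomentBoundRung0`) proves the item
under the flow-invariant homogeneous Gibbs laws; for non-constant profiles the collision-flux (window) argument of
Cercignani–Illner–Pulvirenti 1994 App. 4.A breaks at exactly one point: the mean of the one-window functional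
`W_h ∘ Φ_s` must be evaluated under the EVOLVED law `P_N ∘ Φ_s⁻¹`, which is unknown out of equilibrium.  This file
runs the window argument WITHOUT stationarity and isolates that point as an explicit hypothesis, in a discrete form
that needs no surface measure:

* `lintegral_indicator_collisionSum_le_liminf_sum` — for ANY law `P` (no invariance):
  `∫⁻ 𝟙_{good} K_F dP ≤ liminf_M Σ_{k=1}^{M} ∫ W_M(Φ_{kτ/M} z) dP(z)` (pathwise grid domination + Fatou);
* `norm_sepVec_le_of_contact_freeFlight_neg` — torus geometry: if the pair `(i, j)` of a non-overlapping
  configuration `w` reaches contact after a backward free flight of duration `t ∈ [0, h]`, then NOW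
  `‖xᵢ − xⱼ‖_{𝕋³} ≤ ε + h ‖vᵢ − vⱼ‖` (the pair lies in the `h|g|`-SHELL above contact);
* `lintegral_indicator_collisionMarkSum_le_of_shellBound` — hence, for any law `P`, flow `Φ` on `𝕋³`, horizon
  `τ > 0` and measurable velocity mark `b`: IF the evolved shell functionals are bounded linearly in the shell width,
  `∫ 𝟙{‖xᵢ−xⱼ‖ ≤ ε + h‖vᵢ−vⱼ‖}(Φ_s z) b(vᵢ,vⱼ)(Φ_s z) dP ≤ A h + B h²` for `h ∈ (0,1]`, `s ∈ [0,τ]`, `i ≠ j`,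
  THEN `∫⁻ 𝟙_{good} Σ_{collisions ≤ τ} Σ_{i≠j at contact} b dP ≤ τ A n²` (the `B h²` term dies in the mesh limit);
* `collisionMomentBound_of_shellFluxBound` — **the reduction**: IF for all continuous positive profiles, small
  `σ`, every flow family and horizon there is `A` (uniform in `N`) and `B = B_N` with, for the local Gibbs laws
  `P_N`, all `h ∈ (0,1]`, `s ∈ [0,τ]`, `i ≠ j`,
  `∫ 𝟙{‖xᵢ−xⱼ‖_{𝕋³} ≤ ε_N + h‖vᵢ−vⱼ‖}(Φ_s z) (1 + ‖vᵢ−vⱼ‖³)(Φ_s z) dP_N(z) ≤ A ε_N² h + B h²`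
  (ONE ordered pair; at equilibrium this holds with `A = 64π ∫‖w−v‖(1+‖v−w‖³) dN dN`-type constants, cf. rung 0),
  THEN `CollisionMomentBound` holds, with `C = (t+1) A σ²` (`(N+1)^{-4/3} (N+1)² ε_N² = σ²`).

The hypothesis is the honest open content of the item: an `O(ε_N² h)` bound, uniform in `N` and in `s ≤ τ`, for the
`|g|(1+|g|³)`-weighted probability under the evolved non-equilibrium law that a given pair is within `h|g|` of
contact — i.e. control of the two-particle function of `P_N ∘ Φ_s⁻¹` at the contact scale with a quartic velocity
weight.  Unlike an equilibrium large-deviation input (void for the cubic weight, see the Rung0 docstring), this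
hypothesis is expected to be TRUE; nothing in print proves it for deterministic hard spheres at fixed reduced
density.

References: C. Cercignani, R. Illner, M. Pulvirenti, *The Mathematical Theory of Dilute Gases* (1994), App. 4.A;
H. Spohn, *Large Scale Dynamics of Interacting Particles* (1991), Part I §2.3–§3.
-/

noncomputable section

open MeasureTheory Set Filter Topology
open scoped ENNReal InnerProductSpace BigOperators Classical

namespace Summit.AtomisticToContinuum.HydrodynamicLimit.Theorems.LambertianContactSwapCollisionMomentBound

open Literature.Analysis.FluidPDE Literature.Analysis.FunctionSpaces
  Literature.MathematicalPhysics.KineticTheory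

/-! ### The window bound without stationarity -/

/-- **The window bound for the mean collision sum under an ARBITRARY law** (Cercignani–Illner–Pulvirenti 1994
App. 4.A, minus stationarity).  For a hard-sphere flow `Φ`, any measure `P`, `τ > 0`, a mark `F`, measurable
window events `E M i j` containing every non-overlapping configuration whose pair `(i, j)` comes to contact after a
backward free flight of some duration `t ∈ [0, τ/M]`, and measurable majorants `F (S_{−t} w, i, j) ≤ F̃ M w i j`
there: `∫⁻ 𝟙_{good}(z) Σ_{collision times s ∈ [0,τ]} Σ_{i ≠ j at contact} F(Φ_s z, i, j) dP(z)
   ≤ liminf_M Σ_{k=1}^{M} ∫ Σ_{i≠j} 𝟙_{E M i j}(Φ_{kτ/M} z) F̃ M (Φ_{kτ/M} z, i, j) dP(z)`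
(pathwise grid domination `sum_collision_le_sum_window` and Fatou; the law of `Φ_{kτ/M} z` is left as it is).
[folklore] -/
theorem lintegral_indicator_collisionSum_le_liminf_sum {d X : Type*} [Fintype d] [MeasureSpace X]
    [TopologicalSpace X] {G : Geometry d X} {ε : ℝ} {n : ℕ} (Φ : HardSphereFlow G ε n)
    (P : Measure (Config n d X)) {τ : ℝ} (hτ : 0 < τ) (F : Config n d X → Fin n → Fin n → ℝ≥0∞)
    (E : ℕ → Fin n → Fin n → Set (Config n d X)) (hEm : ∀ M i j, MeasurableSet (E M i j))
    (hE : ∀ (M : ℕ) (i j : Fin n), i ≠ j → ∀ w ∈ hardSphereDomain G n ε, ∀ t ∈ Icc 0 (τ / M),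
      ‖G.sepVec ((freeFlight G (-t) w i).1) ((freeFlight G (-t) w j).1)‖ = ε → w ∈ E M i j)
    (Ft : ℕ → Config n d X → Fin n → Fin n → ℝ≥0∞) (hFtm : ∀ M i j, Measurable fun w => Ft M w i j)
    (hFt : ∀ (M : ℕ) (i j : Fin n), i ≠ j → ∀ w ∈ hardSphereDomain G n ε, ∀ t ∈ Icc 0 (τ / M),
      ‖G.sepVec ((freeFlight G (-t) w i).1) ((freeFlight G (-t) w j).1)‖ = ε →
        F (freeFlight G (-t) w) i j ≤ Ft M w i j) :
    ∫⁻ z, Φ.good.indicator (fun z =>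
        ∑ᶠ s ∈ collisionTimes G ε (fun t => Φ.flow t z) ∩ Icc 0 τ,
          ∑ i, ∑ j, (if i ≠ j ∧ ‖G.sepVec (Φ.flow s z i).1 (Φ.flow s z j).1‖ = ε
            then F (Φ.flow s z) i j else 0)) z ∂P ≤
      liminf (fun M : ℕ => ∑ k ∈ Finset.Icc 1 M,
        ∫⁻ z, ∑ i, ∑ j, (if i ≠ j then (E M i j).indicator (fun w => Ft M w i j)
          (Φ.flow ((k : ℝ) * (τ / M)) z) else 0) ∂P) atTop := by
  classical
  -- the one-window functional and the grid sums
  set W : ℕ → Config n d X → ℝ≥0∞ := fun M w => ∑ i, ∑ j,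
    (if i ≠ j then (E M i j).indicator (fun w => Ft M w i j) w else 0) with hWdef
  have hWm : ∀ M, Measurable (W M) := by
    intro M
    refine Finset.measurable_sum _ fun i _ => Finset.measurable_sum _ fun j _ => ?_
    by_cases hij : i ≠ j
    · simp only [if_pos hij]
      exact (hFtm M i j).indicator (hEm M i j)
    · simp only [if_neg hij]
      exact measurable_const
  set SM : ℕ → Config n d X → ℝ≥0∞ := fun M z =>
    ∑ k ∈ Finset.Icc 1 M, W M (Φ.flow ((k : ℝ) * (τ / M)) z) with hSMdef
  have hSMm : ∀ M, Measurable (SM M) := fun M =>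
    Finset.measurable_sum _ fun k _ => (hWm M).comp (Φ.measurable_flow _)
  set Kstar : Config n d X → ℝ≥0∞ := fun z => liminf (fun M => SM M z) atTop with hKdef
  -- (i) the pathwise bound on the good set
  have hpath : ∀ z ∈ Φ.good, (∑ᶠ s ∈ collisionTimes G ε (fun t => Φ.flow t z) ∩ Icc 0 τ,
      ∑ i, ∑ j, (if i ≠ j ∧ ‖G.sepVec (Φ.flow s z i).1 (Φ.flow s z j).1‖ = ε
        then F (Φ.flow s z) i j else 0)) ≤ Kstar z := by
    intro z hz
    have hγ := Φ.isTrajectory z hz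
    have hfin := hγ.locFinite 0 τ
    rw [finsum_mem_eq_finite_toFinset_sum _ hfin]
    obtain ⟨g, hg, hgap⟩ := exists_gap_of_finite hfin
    show _ ≤ liminf (fun M => SM M z) atTop
    refine le_liminf_of_le (h := ?_)
    filter_upwards [eventually_gt_atTop ⌈τ / g⌉₊] with M hM
    have hM0 : 0 < M := lt_of_le_of_lt (Nat.zero_le _) hM
    have hMg : τ / M < g := by
      have h1 : τ / g < M := (Nat.le_ceil _).trans_lt (by exact_mod_cast hM)
      rw [div_lt_iff₀ hg] at h1
      rw [div_lt_iff₀ (by exact_mod_cast hM0)]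
      linarith
    have hgap' : ∀ s ∈ collisionTimes G ε (fun t => Φ.flow t z) ∩ Icc 0 τ,
        ∀ s' ∈ collisionTimes G ε (fun t => Φ.flow t z) ∩ Icc 0 τ, s < s' → τ / M < s' - s :=
      fun s hs s' hs' hlt => hMg.trans_le (hgap s hs s' hs' hlt)
    exact sum_collision_le_sum_window hγ hτ hM0 hgap' (E M) (hE M) F (Ft M) (hFt M)
  -- (ii) the mean of each grid sum (no stationarity: the law of `Φ_{kh} z` stays)
  have hmeanM : ∀ M, ∫⁻ z, SM M z ∂P =
      ∑ k ∈ Finset.Icc 1 M, ∫⁻ z, W M (Φ.flow ((k : ℝ) * (τ / M)) z) ∂P := fun M =>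
    lintegral_finsetSum _ fun k _ => (hWm M).comp (Φ.measurable_flow _)
  -- (iii) Fatou
  have hmean : ∫⁻ z, Kstar z ∂P ≤
      liminf (fun M : ℕ => ∑ k ∈ Finset.Icc 1 M, ∫⁻ z, W M (Φ.flow ((k : ℝ) * (τ / M)) z) ∂P) atTop := by
    refine (lintegral_liminf_le hSMm).trans (le_of_eq ?_)
    exact congrArg (fun u : ℕ → ℝ≥0∞ => liminf u atTop) (funext hmeanM)
  -- (iv) conclusion
  refine le_trans (lintegral_mono fun z => ?_) hmean
  by_cases hz : z ∈ Φ.good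
  · rw [indicator_of_mem hz]
    exact hpath z hz
  · rw [indicator_of_notMem hz]
    exact zero_le

/-! ### Torus geometry: backward contact within time `h` puts the pair in the `h|g|`-shell -/

/-- On `𝕋³`: if `w` does not overlap at diameter `ε`, `t ∈ [0, h]`, and the pair `(i, j)` of `S_{−t} w` is at
contact, then `‖xᵢ − xⱼ‖_{𝕋³} ≤ ε + h ‖vᵢ − vⱼ‖` (a lift `r` of the relative position has `‖r + t u‖ = ε`,
`u = vⱼ − vᵢ`, and the minimal-image distance is the shortest lift). [folklore] -/
theorem norm_sepVec_le_of_contact_freeFlight_neg {N : ℕ} {ε h : ℝ} {w : Config N (Fin 3) T3}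
    (hw : w ∈ hardSphereDomain (Torus.geometry (Fin 3)) N ε) {i j : Fin N} (hij : i ≠ j) {t : ℝ}
    (ht : t ∈ Icc 0 h)
    (hc : ‖(Torus.geometry (Fin 3)).sepVec ((freeFlight (Torus.geometry (Fin 3)) (-t) w i).1)
        ((freeFlight (Torus.geometry (Fin 3)) (-t) w j).1)‖ = ε) :
    ‖(Torus.geometry (Fin 3)).sepVec (w i).1 (w j).1‖ ≤ ε + h * ‖(w i).2 - (w j).2‖ := by
  have hS : ∀ (u r : V3) (s : ℝ), ε ≤ ‖r‖ → s ∈ Icc 0 h → ‖r + s • u‖ = ε →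
      r ∈ (fun u => {r : V3 | ‖r‖ ≤ ε + h * ‖u‖}) u := by
    intro u r s _ hs hrs
    show ‖r‖ ≤ ε + h * ‖u‖
    calc ‖r‖ = ‖(r + s • u) - s • u‖ := by rw [add_sub_cancel_right]
      _ ≤ ‖r + s • u‖ + ‖s • u‖ := norm_sub_le _ _
      _ = ε + s * ‖u‖ := by rw [hrs, norm_smul, Real.norm_eq_abs, abs_of_nonneg hs.1]
      _ ≤ ε + h * ‖u‖ := by gcongr; exact hs.2
  obtain ⟨k, hk⟩ := exists_latticeVec_add_mem_of_contact hS hw hij ht hc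
  have hk' : ‖Torus.reprSym ((w i).1 - (w j).1) + Torus.latticeVec k‖ ≤ ε + h * ‖(w j).2 - (w i).2‖ := hk
  rw [norm_sub_rev ((w j).2)] at hk'
  rw [Torus.geometry_sepVec]
  exact (norm_reprSym_le_norm_add_latticeVec _ _).trans hk'

/-! ### The collision-flux bound from an evolved shell bound -/

/-- **Mean collision sum from an evolved shell bound.** For a hard-sphere flow `Φ` of `n` spheres of diameter `ε` on
`𝕋³`, ANY law `P`, `τ > 0`, a measurable mark `b(vᵢ, vⱼ) ∈ ℝ≥0∞` and real constants `A, B`: if for all shell widths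
`h ∈ (0, 1]`, times `s ∈ [0, τ]` and ordered pairs `i ≠ j`
`∫ 𝟙{‖xᵢ − xⱼ‖_{𝕋³} ≤ ε + h ‖vᵢ − vⱼ‖}(Φ_s z) · b(vᵢ, vⱼ)(Φ_s z) dP(z) ≤ A h + B h²`,
then `∫⁻ 𝟙_{good}(z) Σ_{collision times ≤ τ} Σ_{i≠j at contact} b(vᵢ(s), vⱼ(s)) dP(z) ≤ τ A n²`
(window bound with mesh `τ/M`: `M` windows × `n²` pairs × `(A τ/M + B τ²/M²)` → `τ A n²`). [folklore] -/
theorem lintegral_indicator_collisionMarkSum_le_of_shellBound {n : ℕ} {ε : ℝ}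
    (Φ : HardSphereFlow (Torus.geometry (Fin 3)) ε n) (P : Measure (Config n (Fin 3) T3))
    {τ : ℝ} (hτ : 0 < τ) {b : V3 × V3 → ℝ≥0∞} (hbm : Measurable b) {A B : ℝ}
    (hshell : ∀ h ∈ Ioc (0 : ℝ) 1, ∀ s ∈ Icc (0 : ℝ) τ, ∀ i j : Fin n, i ≠ j →
      ∫⁻ z, {w : Config n (Fin 3) T3 | ‖(Torus.geometry (Fin 3)).sepVec (w i).1 (w j).1‖ ≤
          ε + h * ‖(w i).2 - (w j).2‖}.indicator (fun w => b ((w i).2, (w j).2)) (Φ.flow s z) ∂P ≤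
        ENNReal.ofReal (A * h + B * h ^ 2)) :
    ∫⁻ z, Φ.good.indicator (fun z =>
        ∑ᶠ s ∈ collisionTimes (Torus.geometry (Fin 3)) ε (fun t => Φ.flow t z) ∩ Icc 0 τ,
          ∑ i : Fin n, ∑ j : Fin n,
            (if i ≠ j ∧ ‖(Torus.geometry (Fin 3)).sepVec (Φ.flow s z i).1 (Φ.flow s z j).1‖ = ε
              then b ((Φ.flow s z i).2, (Φ.flow s z j).2) else 0)) z ∂P ≤
      ENNReal.ofReal (τ * A * (n : ℝ) ^ 2) := by
  classical
  -- the mark and the shell events of width `τ / M`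
  set F : Config n (Fin 3) T3 → Fin n → Fin n → ℝ≥0∞ := fun w i j => b ((w i).2, (w j).2) with hFdef
  have hFm : ∀ i j, Measurable fun w => F w i j :=
    fun i j => hbm.comp ((measurable_pi_apply i).snd.prodMk (measurable_pi_apply j).snd)
  set E : ℕ → Fin n → Fin n → Set (Config n (Fin 3) T3) := fun M i j =>
    {w | ‖(Torus.geometry (Fin 3)).sepVec (w i).1 (w j).1‖ ≤ ε + τ / M * ‖(w i).2 - (w j).2‖} with hEdef
  have hsepm : ∀ i j : Fin n, Measurable fun w : Config n (Fin 3) T3 =>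
      (Torus.geometry (Fin 3)).sepVec (w i).1 (w j).1 := fun i j =>
    Torus.measurable_geometry_sepVec.comp ((measurable_pi_apply i).fst.prodMk (measurable_pi_apply j).fst)
  have hEm : ∀ M i j, MeasurableSet (E M i j) := by
    intro M i j
    refine measurableSet_le (hsepm i j).norm ?_
    exact measurable_const.add (measurable_const.mul
      ((measurable_pi_apply i).snd.sub (measurable_pi_apply j).snd).norm)
  have hE : ∀ (M : ℕ) (i j : Fin n), i ≠ j →
      ∀ w ∈ hardSphereDomain (Torus.geometry (Fin 3)) n ε, ∀ t ∈ Icc 0 (τ / M),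
      ‖(Torus.geometry (Fin 3)).sepVec ((freeFlight (Torus.geometry (Fin 3)) (-t) w i).1)
        ((freeFlight (Torus.geometry (Fin 3)) (-t) w j).1)‖ = ε → w ∈ E M i j :=
    fun M i j hij w hw t ht hc => norm_sepVec_le_of_contact_freeFlight_neg hw hij ht hc
  have hFt : ∀ (M : ℕ) (i j : Fin n), i ≠ j →
      ∀ w ∈ hardSphereDomain (Torus.geometry (Fin 3)) n ε, ∀ t ∈ Icc 0 (τ / M),
      ‖(Torus.geometry (Fin 3)).sepVec ((freeFlight (Torus.geometry (Fin 3)) (-t) w i).1)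
        ((freeFlight (Torus.geometry (Fin 3)) (-t) w j).1)‖ = ε →
        F (freeFlight (Torus.geometry (Fin 3)) (-t) w) i j ≤ (fun _ => F) M w i j := by
    intro M i j _ w _ t _ _
    simp only [hFdef, freeFlight_apply, le_refl]
  -- the generic window bound
  have hgen := lintegral_indicator_collisionSum_le_liminf_sum Φ P hτ F E hEm hE (fun _ => F)
    (fun _ i j => hFm i j) hFt
  refine hgen.trans ?_
  -- the bound for one window, `M ≥ τ` (so that `h = τ / M ≤ 1`)
  have hwin : ∀ M : ℕ, 0 < M → τ ≤ M → ∀ k ∈ Finset.Icc 1 M,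
      ∫⁻ z, ∑ i, ∑ j, (if i ≠ j then (E M i j).indicator (fun w => F w i j)
          (Φ.flow ((k : ℝ) * (τ / M)) z) else 0) ∂P ≤
        (n : ℝ≥0∞) ^ 2 * ENNReal.ofReal (A * (τ / M) + B * (τ / M) ^ 2) := by
    intro M hM hτM k hk
    have hM' : (0 : ℝ) < M := by exact_mod_cast hM
    have hh : τ / M ∈ Ioc (0 : ℝ) 1 := ⟨div_pos hτ hM', (div_le_one hM').2 hτM⟩
    rw [Finset.mem_Icc] at hk
    have hs : (k : ℝ) * (τ / M) ∈ Icc (0 : ℝ) τ := by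
      refine ⟨by positivity, ?_⟩
      have hkM : (k : ℝ) ≤ M := by exact_mod_cast hk.2
      calc (k : ℝ) * (τ / M) ≤ M * (τ / M) := by gcongr
        _ = τ := mul_div_cancel₀ _ hM'.ne'
    have hmeas : ∀ i j : Fin n, Measurable fun z : Config n (Fin 3) T3 =>
        (if i ≠ j then (E M i j).indicator (fun w => F w i j) (Φ.flow ((k : ℝ) * (τ / M)) z) else 0) := by
      intro i j
      by_cases hij : i ≠ j
      · simp only [if_pos hij]
        exact ((hFm i j).indicator (hEm M i j)).comp (Φ.measurable_flow _)
      · simp only [if_neg hij]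
        exact measurable_const
    have hterm : ∀ i j : Fin n, ∫⁻ z, (if i ≠ j then (E M i j).indicator (fun w => F w i j)
        (Φ.flow ((k : ℝ) * (τ / M)) z) else 0) ∂P ≤ ENNReal.ofReal (A * (τ / M) + B * (τ / M) ^ 2) := by
      intro i j
      by_cases hij : i ≠ j
      · simp only [if_pos hij]
        exact hshell _ hh _ hs i j hij
      · simp only [if_neg hij, lintegral_zero, zero_le]
    calc ∫⁻ z, ∑ i, ∑ j, (if i ≠ j then (E M i j).indicator (fun w => F w i j)
            (Φ.flow ((k : ℝ) * (τ / M)) z) else 0) ∂P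
        = ∑ i, ∑ j, ∫⁻ z, (if i ≠ j then (E M i j).indicator (fun w => F w i j)
            (Φ.flow ((k : ℝ) * (τ / M)) z) else 0) ∂P := by
          rw [lintegral_finsetSum _ fun i _ => Finset.measurable_sum _ fun j _ => hmeas i j]
          exact Finset.sum_congr rfl fun i _ => lintegral_finsetSum _ fun j _ => hmeas i j
      _ ≤ ∑ _i : Fin n, ∑ _j : Fin n, ENNReal.ofReal (A * (τ / M) + B * (τ / M) ^ 2) := by
          gcongr with i _ j _
          exact hterm i j
      _ = (n : ℝ≥0∞) ^ 2 * ENNReal.ofReal (A * (τ / M) + B * (τ / M) ^ 2) := by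
          simp only [Finset.sum_const, Finset.card_univ, Fintype.card_fin, nsmul_eq_mul]
          ring
  -- summing the `M` windows: eventually `≤ n² (A τ + B τ² / M)`
  set v : ℕ → ℝ≥0∞ := fun M => ENNReal.ofReal ((n : ℝ) ^ 2 * (A * τ + B * τ ^ 2 / M)) with hvdef
  have hev : ∀ᶠ M : ℕ in atTop, (∑ k ∈ Finset.Icc 1 M,
      ∫⁻ z, ∑ i, ∑ j, (if i ≠ j then (E M i j).indicator (fun w => F w i j)
          (Φ.flow ((k : ℝ) * (τ / M)) z) else 0) ∂P) ≤ v M := by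
    filter_upwards [eventually_gt_atTop 0, eventually_ge_atTop ⌈τ⌉₊] with M hM hMτ
    have hM' : (0 : ℝ) < M := by exact_mod_cast hM
    have hτM : τ ≤ M := (Nat.le_ceil τ).trans (by exact_mod_cast hMτ)
    calc (∑ k ∈ Finset.Icc 1 M, ∫⁻ z, ∑ i, ∑ j, (if i ≠ j then (E M i j).indicator (fun w => F w i j)
            (Φ.flow ((k : ℝ) * (τ / M)) z) else 0) ∂P)
        ≤ ∑ _k ∈ Finset.Icc 1 M, (n : ℝ≥0∞) ^ 2 * ENNReal.ofReal (A * (τ / M) + B * (τ / M) ^ 2) :=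
          Finset.sum_le_sum fun k hk => hwin M hM hτM k hk
      _ = (M : ℝ≥0∞) * ((n : ℝ≥0∞) ^ 2 * ENNReal.ofReal (A * (τ / M) + B * (τ / M) ^ 2)) := by
          rw [Finset.sum_const, Nat.card_Icc, Nat.add_sub_cancel, nsmul_eq_mul]
      _ = v M := by
          rw [hvdef]
          have h1 : (M : ℝ≥0∞) = ENNReal.ofReal (M : ℝ) := (ENNReal.ofReal_natCast M).symm
          have h2 : ((n : ℝ≥0∞)) ^ 2 = ENNReal.ofReal ((n : ℝ) ^ 2) := by
            rw [← ENNReal.ofReal_natCast n, ENNReal.ofReal_pow (Nat.cast_nonneg _)]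
          rw [h1, h2, ← ENNReal.ofReal_mul (by positivity), ← ENNReal.ofReal_mul (Nat.cast_nonneg _)]
          congr 1
          field_simp
  have hvlim : Tendsto v atTop (𝓝 (ENNReal.ofReal ((n : ℝ) ^ 2 * (A * τ + 0)))) := by
    rw [hvdef]
    refine ENNReal.tendsto_ofReal (Tendsto.const_mul _ (tendsto_const_nhds.add ?_))
    exact tendsto_const_div_atTop_nhds_zero_nat (B * τ ^ 2)
  calc liminf (fun M : ℕ => ∑ k ∈ Finset.Icc 1 M,
          ∫⁻ z, ∑ i, ∑ j, (if i ≠ j then (E M i j).indicator (fun w => F w i j)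
            (Φ.flow ((k : ℝ) * (τ / M)) z) else 0) ∂P) atTop
      ≤ liminf v atTop := liminf_le_liminf hev
    _ = ENNReal.ofReal ((n : ℝ) ^ 2 * (A * τ + 0)) := hvlim.liminf_eq
    _ = ENNReal.ofReal (τ * A * (n : ℝ) ^ 2) := by
        congr 1
        ring

/-! ### The reduction of the item -/

/-- **`CollisionMomentBound` follows from an evolved shell bound for the local Gibbs laws.** IF for all continuous
profiles `a₀, θ₀ > 0`, `u₀` there is `σ₀ > 0` such that for `0 < σ < σ₀`, every flow family `Φ` and every horizon
`τ > 0` there is a constant `A` (uniform in `N`) and, for every `N`, a constant `B` with, for all shell widths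
`h ∈ (0, 1]`, times `s ∈ [0, τ]` and ordered pairs `i ≠ j` of the `N + 1` spheres,
`∫ 𝟙{‖xᵢ − xⱼ‖_{𝕋³} ≤ ε_N + h ‖vᵢ − vⱼ‖}(Φ_s z) (1 + ‖vᵢ − vⱼ‖³)(Φ_s z) dP_N(z) ≤ A ε_N² h + B h²`
(`P_N = localGibbsLaw σ a₀ u₀ θ₀ N (Φ N)`, `ε_N = hsDiameter σ N`) — the `|g|³`-weighted probability, under the
TIME-EVOLVED local Gibbs law, that a given pair is within `h|g|` of contact is `O(ε_N² h)` uniformly in `N` and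
`s ≤ τ` — THEN the route decl `CollisionMomentBound` holds, with `C = (t+1) max(A,0) σ²`.  Proof: the window argument
without stationarity (`lintegral_indicator_collisionMarkSum_le_of_shellBound`), the pathwise bridge from the item's
encoding (`ofReal_hitSum_le_collisionSum_flow`, collision invariance of `‖vᵢ − vⱼ‖`), and
`(N+1)^{-4/3} (N+1)² ε_N² = σ²`.  The hypothesis holds at equilibrium (rung 0); out of equilibrium it is the open
content of the item. [folklore] -/
theorem collisionMomentBound_of_shellFluxBound
    (hShell : ∀ (a₀ θ₀ : T3 → ℝ) (u₀ : T3 → V3), Continuous a₀ → Continuous θ₀ → Continuous u₀ →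
      (∀ x, 0 < a₀ x) → (∀ x, 0 < θ₀ x) → ∃ σ₀ : ℝ, 0 < σ₀ ∧ ∀ σ : ℝ, 0 < σ → σ < σ₀ →
      ∀ Φ : (N : ℕ) → HardSphereFlow (Torus.geometry (Fin 3)) (hsDiameter σ N) (N + 1),
      ∀ τ : ℝ, 0 < τ → ∃ A : ℝ, ∀ N : ℕ, ∃ B : ℝ, ∀ h ∈ Ioc (0 : ℝ) 1, ∀ s ∈ Icc (0 : ℝ) τ,
      ∀ i j : Fin (N + 1), i ≠ j →
        ∫⁻ z, {w : Config (N + 1) (Fin 3) T3 |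
            ‖(Torus.geometry (Fin 3)).sepVec (w i).1 (w j).1‖ ≤
              hsDiameter σ N + h * ‖(w i).2 - (w j).2‖}.indicator
            (fun w => ENNReal.ofReal (1 + ‖(w i).2 - (w j).2‖ ^ 3)) ((Φ N).flow s z)
          ∂(localGibbsLaw σ a₀ u₀ θ₀ N (Φ N)) ≤
        ENNReal.ofReal (A * hsDiameter σ N ^ 2 * h + B * h ^ 2)) :
    Summit.AtomisticToContinuum.HydrodynamicLimit.Theses.LambertianContactSwap.CollisionMomentBound := by
  unfold Summit.AtomisticToContinuum.HydrodynamicLimit.Theses.LambertianContactSwap.CollisionMomentBound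
  dsimp only
  intro a₀ θ₀ u₀ ha hθ hu ha0 hθ0
  obtain ⟨σ₀, hσ₀, hsh⟩ := hShell a₀ θ₀ u₀ ha hθ hu ha0 hθ0
  refine ⟨min σ₀ (1 / 2), lt_min hσ₀ (by norm_num), fun σ hσ hσlt Φ t ht => ?_⟩
  have hσ₀' : σ < σ₀ := hσlt.trans_le (min_le_left _ _)
  have hσ2 : σ < 1 / 2 := hσlt.trans_le (min_le_right _ _)
  set τ : ℝ := t + 1 with hτdef
  have hτ0 : 0 < τ := by rw [hτdef]; linarith
  have htτ : t ≤ τ := by rw [hτdef]; linarith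
  obtain ⟨A, hAN⟩ := hsh σ hσ hσ₀' Φ τ hτ0
  refine ⟨τ * max A 0 * σ ^ 2, fun N => ?_⟩
  obtain ⟨B, hB⟩ := hAN N
  rcases Nat.eq_zero_or_pos N with rfl | hNpos
  · -- one sphere: no pair `i < j`, the sum vanishes identically
    have hnot : ∀ (i j : Fin (0 + 1)) (Q : Prop), (i < j ∧ Q) ↔ False := by
      intro i j Q
      simp only [iff_false, not_and]
      intro hij
      exact absurd (Fin.lt_def.1 hij) (by have := i.2; have := j.2; omega)
    simp only [hnot, if_false, Finset.sum_const_zero, mul_zero, ENNReal.ofReal_zero, lintegral_const,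
      zero_mul]
    exact zero_le
  -- `N ≥ 1`
  have hε2 : hsDiameter σ N < 2⁻¹ := by
    have h1 := hsDiameter_le hσ.le N
    rw [inv_eq_one_div]
    linarith
  have hG := Torus.isHardSphereRegular_geometry (d := Fin 3) hε2
  set P := localGibbsLaw σ a₀ u₀ θ₀ N (Φ N) with hP
  have hgood : ∀ᵐ z ∂P, z ∈ (Φ N).good := ae_mem_good_localGibbsLaw σ _ _ _ N (Φ N)
  have hc : 0 ≤ ((N : ℝ) + 1) ^ (-(4 / 3 : ℝ)) := Real.rpow_nonneg (by positivity) _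
  -- the mark
  set b : V3 × V3 → ℝ≥0∞ := fun p => ENNReal.ofReal (1 + ‖p.1 - p.2‖ ^ 3) with hb
  have hbm : Measurable b := by rw [hb]; fun_prop
  -- the evolved shell bound, with nonnegative constants
  have hshell : ∀ h ∈ Ioc (0 : ℝ) 1, ∀ s ∈ Icc (0 : ℝ) τ, ∀ i j : Fin (N + 1), i ≠ j →
      ∫⁻ z, {w : Config (N + 1) (Fin 3) T3 | ‖(Torus.geometry (Fin 3)).sepVec (w i).1 (w j).1‖ ≤
          hsDiameter σ N + h * ‖(w i).2 - (w j).2‖}.indicator (fun w => b ((w i).2, (w j).2))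
          ((Φ N).flow s z) ∂P ≤
        ENNReal.ofReal (max A 0 * hsDiameter σ N ^ 2 * h + max B 0 * h ^ 2) := by
    intro h hh s hs i j hij
    refine (hB h hh s hs i j hij).trans (ENNReal.ofReal_le_ofReal ?_)
    have h1 : A * hsDiameter σ N ^ 2 * h ≤ max A 0 * hsDiameter σ N ^ 2 * h :=
      mul_le_mul_of_nonneg_right (mul_le_mul_of_nonneg_right (le_max_left _ _) (sq_nonneg _)) hh.1.le
    have h2 : B * h ^ 2 ≤ max B 0 * h ^ 2 := mul_le_mul_of_nonneg_right (le_max_left _ _) (sq_nonneg _)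
    linarith
  have hflux := lintegral_indicator_collisionMarkSum_le_of_shellBound (Φ N) P hτ0 hbm hshell
  -- the constants: `(N+1)^{-4/3} · τ (max A 0) ε² (N+1)² = τ (max A 0) σ²`
  have harith : ENNReal.ofReal (((N : ℝ) + 1) ^ (-(4 / 3 : ℝ))) *
      ENNReal.ofReal (τ * (max A 0 * hsDiameter σ N ^ 2) * ((N + 1 : ℕ) : ℝ) ^ 2) =
      ENNReal.ofReal (τ * max A 0 * σ ^ 2) := by
    rw [← ENNReal.ofReal_mul hc]
    congr 1
    have h := rpow_mul_sq_mul_hsDiameter_sq σ N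
    calc ((N : ℝ) + 1) ^ (-(4 / 3 : ℝ)) * (τ * (max A 0 * hsDiameter σ N ^ 2) * ((N + 1 : ℕ) : ℝ) ^ 2)
        = τ * max A 0 * (((N : ℝ) + 1) ^ (-(4 / 3 : ℝ)) * ((N + 1 : ℕ) : ℝ) ^ 2 *
            hsDiameter σ N ^ 2) := by ring
      _ = τ * max A 0 * σ ^ 2 := by rw [h]
  rw [← harith]
  -- pathwise domination on the good set (the bridge) and integration
  refine lintegral_ofReal_mul_le P hc hgood hflux fun z hz => ?_
  refine ofReal_hitSum_le_collisionSum_flow hG (Φ N) hz ht htτ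
    (fun y i j => 1 + ‖(y i).2 - (y j).2‖ ^ 3) (fun y i j => by positivity)
    (fun w i j => b ((w i).2, (w j).2)) fun y p hp => ?_
  show ENNReal.ofReal (1 + ‖(y p.1).2 - (y p.2).2‖ ^ 3) ≤
    ENNReal.ofReal (1 + ‖(collidePair (Torus.geometry (Fin 3)) p.1 p.2 y p.1).2 -
      (collidePair (Torus.geometry (Fin 3)) p.1 p.2 y p.2).2‖ ^ 3)
  rw [norm_vel_sub_vel_collidePair _ hp.ne y]

/-! ### The reduction of the item -/

end Summit.AtomisticToContinuum.HydrodynamicLimit.Theorems.LambertianContactSwapCollisionMomentBound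

end
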